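import Summits.ABC.ABC.Theorems.TwistAmplificationSharpModerateLawLatticeShell
import Literature.NumberTheory.CubicFields.MemUCriterion

/-!
# Lattice half of `SharpModerateLaw`, support file 3/4: zeros of a maximal form modulo `M`

Local arithmetic of `stub_latticeHalf` (crux stmt-ABC-1975, line `syzygy-lattice-half-deep-few-primes`):

* `cls N q = {x : N ∣ det(q, x)}` — the class (lattice) of a primitive `q` modulo `N`; `cls_eq`;
* `exists_dvd_dt_of_four` — Lagrange interpolation at four points: if `p ∤ F` and `p ∣ F(qᵢ)`
  (`i < 4`), two of the `qᵢ` are proportional mod `p` (at most three projective roots);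
* `pow_dvd_dt` — Hensel uniqueness: under the Davenport–Heilbronn `U_p` condition (no singular
  zero, `BinaryCubic.memU_iff_forall_coprime`), `pᵏ ∣ F(q), F(q')` and `p ∣ det(q,q')` force
  `pᵏ ∣ det(q,q')`;
* `card_image_cls_le` (≤ 3 classes mod `pᵏ`) and the CRT assembly `card_le_of_classes` /
  `latticeArith_main`: a finite set of primitive `q` with `M ∣ F(q)` whose classes mod `M` have
  `≤ b` elements has `≤ 3^{ω(M)} b` elements;
* `pow_card_primeFactors_le` — `c^{ω(n)} ≤ K n^δ`.
-/

noncomputable section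

namespace Summit.ABC.ABC.Theorems.SharpModerateLaw

open Literature.NumberTheory.CubicFields
open UniqueFactorizationMonoid
open Finset

/-! ## Local classes of the zeros of `F` modulo prime powers -/

/-- The class of `q` modulo `N`: the lattice `{x : N ∣ det(q, x)}`. -/
def cls (N : ℕ) (q : ℤ × ℤ) : Set (ℤ × ℤ) := {x | (N : ℤ) ∣ dt q x}

/-- `q ∈ cls N q`. -/
theorem mem_cls_self (N : ℕ) (q : ℤ × ℤ) : q ∈ cls N q := by
  simp [cls, dt, mul_comm]

/-- For `q'` primitive with `N ∣ det(q, q')`: `cls N q' ⊆ cls N q`. -/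
theorem cls_subset {N : ℕ} {q q' : ℤ × ℤ} (hq' : Int.gcd q'.1 q'.2 = 1) (h : (N : ℤ) ∣ dt q q') :
    cls N q' ⊆ cls N q := by
  intro x hx
  simp only [cls, Set.mem_setOf_eq] at hx ⊢
  obtain ⟨α, β, hαβ⟩ := Int.isCoprime_iff_gcd_eq_one.mpr hq'
  have h1 : (N : ℤ) ∣ q'.1 * dt q x := by
    have : q'.1 * dt q x = q.1 * dt q' x + x.1 * dt q q' := by simp only [dt]; ring
    rw [this]; exact dvd_add (dvd_mul_of_dvd_right hx _) (dvd_mul_of_dvd_right h _)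
  have h2 : (N : ℤ) ∣ q'.2 * dt q x := by
    have : q'.2 * dt q x = q.2 * dt q' x + x.2 * dt q q' := by simp only [dt]; ring
    rw [this]; exact dvd_add (dvd_mul_of_dvd_right hx _) (dvd_mul_of_dvd_right h _)
  have : dt q x = α * (q'.1 * dt q x) + β * (q'.2 * dt q x) := by
    linear_combination (-dt q x) * hαβ
  rw [this]; exact dvd_add (dvd_mul_of_dvd_right h1 _) (dvd_mul_of_dvd_right h2 _)

/-- Two primitive vectors with `N ∣ det` have the same class. -/
theorem cls_eq {N : ℕ} {q q' : ℤ × ℤ} (hq : Int.gcd q.1 q.2 = 1) (hq' : Int.gcd q'.1 q'.2 = 1)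
    (h : (N : ℤ) ∣ dt q q') : cls N q = cls N q' := by
  refine Set.Subset.antisymm (cls_subset hq ?_) (cls_subset hq' h)
  have : dt q' q = -dt q q' := by simp only [dt]; ring
  rw [this]; exact dvd_neg.mpr h

/-- Lagrange interpolation at four points (coefficientwise): if `p ∣ F(qᵢ)` for `i < 4` then
`p ∣ (coefficient) · V` with `V` the product of the six determinants. -/
theorem dvd_coeff_mul_dets (F : BinaryCubic ℤ) {p : ℤ} {u₀ v₀ u₁ v₁ u₂ v₂ u₃ v₃ : ℤ}
    (h0 : p ∣ F.eval u₀ v₀) (h1 : p ∣ F.eval u₁ v₁) (h2 : p ∣ F.eval u₂ v₂)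
    (h3 : p ∣ F.eval u₃ v₃) :
    let V := (u₀ * v₁ - v₀ * u₁) * (u₀ * v₂ - v₀ * u₂) * (u₀ * v₃ - v₀ * u₃) * (u₁ * v₂ - v₁ * u₂) *
      (u₁ * v₃ - v₁ * u₃) * (u₂ * v₃ - v₂ * u₃)
    p ∣ F.a * V ∧ p ∣ F.b * V ∧ p ∣ F.c * V ∧ p ∣ F.d * V := by
  intro V
  set ρ0 := (u₁ * v₂ - v₁ * u₂) * (u₁ * v₃ - v₁ * u₃) * (u₂ * v₃ - v₂ * u₃)
  set ρ1 := (u₀ * v₂ - v₀ * u₂) * (u₀ * v₃ - v₀ * u₃) * (u₂ * v₃ - v₂ * u₃)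
  set ρ2 := (u₀ * v₁ - v₀ * u₁) * (u₀ * v₃ - v₀ * u₃) * (u₁ * v₃ - v₁ * u₃)
  set ρ3 := (u₀ * v₁ - v₀ * u₁) * (u₀ * v₂ - v₀ * u₂) * (u₁ * v₂ - v₁ * u₂)
  have ka : F.a * V = -F.eval u₀ v₀ * (ρ0 * -(v₁ * v₂ * v₃)) + F.eval u₁ v₁ * (ρ1 * -(v₀ * v₂ * v₃))
      - F.eval u₂ v₂ * (ρ2 * -(v₀ * v₁ * v₃)) + F.eval u₃ v₃ * (ρ3 * -(v₀ * v₁ * v₂)) := by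
    simp only [V, ρ0, ρ1, ρ2, ρ3, BinaryCubic.eval]; ring
  have kb : F.b * V = -F.eval u₀ v₀ * (ρ0 * (v₁ * v₂ * u₃ + v₁ * u₂ * v₃ + u₁ * v₂ * v₃))
      + F.eval u₁ v₁ * (ρ1 * (v₀ * v₂ * u₃ + v₀ * u₂ * v₃ + u₀ * v₂ * v₃))
      - F.eval u₂ v₂ * (ρ2 * (v₀ * v₁ * u₃ + v₀ * u₁ * v₃ + u₀ * v₁ * v₃))
      + F.eval u₃ v₃ * (ρ3 * (v₀ * v₁ * u₂ + v₀ * u₁ * v₂ + u₀ * v₁ * v₂)) := by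
    simp only [V, ρ0, ρ1, ρ2, ρ3, BinaryCubic.eval]; ring
  have kc : F.c * V = -F.eval u₀ v₀ * (ρ0 * -(v₁ * u₂ * u₃ + u₁ * v₂ * u₃ + u₁ * u₂ * v₃))
      + F.eval u₁ v₁ * (ρ1 * -(v₀ * u₂ * u₃ + u₀ * v₂ * u₃ + u₀ * u₂ * v₃))
      - F.eval u₂ v₂ * (ρ2 * -(v₀ * u₁ * u₃ + u₀ * v₁ * u₃ + u₀ * u₁ * v₃))
      + F.eval u₃ v₃ * (ρ3 * -(v₀ * u₁ * u₂ + u₀ * v₁ * u₂ + u₀ * u₁ * v₂)) := by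
    simp only [V, ρ0, ρ1, ρ2, ρ3, BinaryCubic.eval]; ring
  have kd : F.d * V = -F.eval u₀ v₀ * (ρ0 * (u₁ * u₂ * u₃)) + F.eval u₁ v₁ * (ρ1 * (u₀ * u₂ * u₃))
      - F.eval u₂ v₂ * (ρ2 * (u₀ * u₁ * u₃)) + F.eval u₃ v₃ * (ρ3 * (u₀ * u₁ * u₂)) := by
    simp only [V, ρ0, ρ1, ρ2, ρ3, BinaryCubic.eval]; ring
  have hcomb : ∀ A B C D : ℤ, p ∣ -F.eval u₀ v₀ * A + F.eval u₁ v₁ * B - F.eval u₂ v₂ * C +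
      F.eval u₃ v₃ * D := fun A B C D =>
    dvd_add (dvd_sub (dvd_add ((dvd_neg.mpr h0).mul_right _) (h1.mul_right _)) (h2.mul_right _))
      (h3.mul_right _)
  exact ⟨ka ▸ hcomb _ _ _ _, kb ▸ hcomb _ _ _ _, kc ▸ hcomb _ _ _ _, kd ▸ hcomb _ _ _ _⟩

/-- **At most three roots modulo `p`.** If `p ∤ F` and `p ∣ F(qᵢ)` for four vectors, two of them are
proportional modulo `p`. -/
theorem exists_dvd_dt_of_four {F : BinaryCubic ℤ} {p : ℕ} (hp : p.Prime) (hF : ¬ F.IsMultiple p)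
    (q : Fin 4 → ℤ × ℤ) (hq : ∀ i, (p : ℤ) ∣ F.eval (q i).1 (q i).2) :
    ∃ i j, i ≠ j ∧ (p : ℤ) ∣ dt (q i) (q j) := by
  have hp' : Prime (p : ℤ) := Nat.prime_iff_prime_int.mp hp
  obtain ⟨ha, hb, hc, hd⟩ := dvd_coeff_mul_dets F (hq 0) (hq 1) (hq 2) (hq 3)
  set V := ((q 0).1 * (q 1).2 - (q 0).2 * (q 1).1) * ((q 0).1 * (q 2).2 - (q 0).2 * (q 2).1) *
    ((q 0).1 * (q 3).2 - (q 0).2 * (q 3).1) * ((q 1).1 * (q 2).2 - (q 1).2 * (q 2).1) *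
    ((q 1).1 * (q 3).2 - (q 1).2 * (q 3).1) * ((q 2).1 * (q 3).2 - (q 2).2 * (q 3).1) with hV
  by_cases hV0 : (p : ℤ) ∣ V
  · simp only [hV] at hV0
    rcases hp'.dvd_or_dvd hV0 with h | h
    · rcases hp'.dvd_or_dvd h with h | h
      · rcases hp'.dvd_or_dvd h with h | h
        · rcases hp'.dvd_or_dvd h with h | h
          · rcases hp'.dvd_or_dvd h with h | h
            · exact ⟨0, 1, by decide, h⟩
            · exact ⟨0, 2, by decide, h⟩
          · exact ⟨0, 3, by decide, h⟩
        · exact ⟨1, 2, by decide, h⟩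
      · exact ⟨1, 3, by decide, h⟩
    · exact ⟨2, 3, by decide, h⟩
  · exfalso
    refine hF ⟨?_, ?_, ?_, ?_⟩
    · exact (hp'.dvd_or_dvd ha).resolve_right hV0
    · exact (hp'.dvd_or_dvd hb).resolve_right hV0
    · exact (hp'.dvd_or_dvd hc).resolve_right hV0
    · exact (hp'.dvd_or_dvd hd).resolve_right hV0

/-- **Hensel uniqueness on simple roots.** If `F` has no singular zero modulo `p` (the `U_p`
condition at primitive points), `pᵏ ∣ F(q), F(q')` for primitive `q, q'` that are proportional
modulo `p`, then they are proportional modulo `pᵏ`. -/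
theorem pow_dvd_dt {F : BinaryCubic ℤ} {p : ℕ} (hp : p.Prime)
    (hU : ∀ x y : ℤ, IsCoprime x y → (p : ℤ) ^ 2 ∣ F.eval x y → (p : ℤ) ∣ F.derivU x y →
      ¬ (p : ℤ) ∣ F.derivV x y)
    {q q' : ℤ × ℤ} (hq : Int.gcd q.1 q.2 = 1) (hq' : Int.gcd q'.1 q'.2 = 1) {k : ℕ}
    (hk : (p : ℤ) ^ k ∣ F.eval q.1 q.2) (hk' : (p : ℤ) ^ k ∣ F.eval q'.1 q'.2)
    (h1 : (p : ℤ) ∣ dt q q') : (p : ℤ) ^ k ∣ dt q q' := by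
  haveI := Fact.mk hp
  have hp' : Prime (p : ℤ) := Nat.prime_iff_prime_int.mp hp
  by_cases hz : dt q q' = 0
  · rw [hz]; exact dvd_zero _
  by_contra hcon
  set j := padicValInt p (dt q q') with hjdef
  have hjk : j < k := by
    by_contra h; push Not at h
    exact hcon ((padicValInt_dvd_iff k _).mpr (Or.inr h))
  have hj1 : 1 ≤ j := by
    rcases (padicValInt_dvd_iff 1 (dt q q')).mp (by simpa using h1) with h | h
    · exact absurd h hz
    · exact h
  obtain ⟨e, he⟩ := padicValInt_dvd (p := p) (dt q q')
  rw [← hjdef] at he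
  have hpe : ¬ (p : ℤ) ∣ e := by
    rintro ⟨e', rfl⟩
    have : (p : ℤ) ^ (j + 1) ∣ dt q q' := ⟨e', by rw [he]; ring⟩
    rcases (padicValInt_dvd_iff (j + 1) _).mp this with h | h
    · exact hz h
    · rw [← hjdef] at h; omega
  -- Bézout completion of `q` and the decomposition `q' = cc • q + p^j • z`
  obtain ⟨α, β, hαβ⟩ := Int.isCoprime_iff_gcd_eq_one.mpr hq
  set cc : ℤ := q'.1 * α + q'.2 * β with hcc
  set z : ℤ × ℤ := (e * (-β), e * α) with hzdef
  have hq'1 : q'.1 = cc * q.1 + (p : ℤ) ^ j * z.1 := by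
    have : (p : ℤ) ^ j * z.1 = dt q q' * (-β) := by rw [he]; simp only [z]; ring
    rw [this]; simp only [hcc, dt]; linear_combination (-q'.1) * hαβ
  have hq'2 : q'.2 = cc * q.2 + (p : ℤ) ^ j * z.2 := by
    have : (p : ℤ) ^ j * z.2 = dt q q' * α := by rw [he]; simp only [z]; ring
    rw [this]; simp only [hcc, dt]; linear_combination (-q'.2) * hαβ
  have hdetz : q.1 * z.2 - q.2 * z.1 = e := by
    simp only [z]; linear_combination e * hαβ
  -- `p ∤ cc` since `q'` is primitive
  have hpcc : ¬ (p : ℤ) ∣ cc := by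
    intro hc
    have hpj : (p : ℤ) ∣ (p : ℤ) ^ j := dvd_pow_self _ (by omega)
    have d1 : (p : ℤ) ∣ q'.1 := by
      rw [hq'1]; exact dvd_add (hc.mul_right _) (hpj.mul_right _)
    have d2 : (p : ℤ) ∣ q'.2 := by
      rw [hq'2]; exact dvd_add (hc.mul_right _) (hpj.mul_right _)
    have := Int.gcd_eq_one_iff.mp hq' _ d1 d2
    exact hp.ne_one (by exact_mod_cast Int.eq_one_of_dvd_one (by positivity) this)
  -- the form `f(s, t) = F(s q + t z)`
  let γ : Matrix (Fin 2) (Fin 2) ℤ := !![q.1, q.2; z.1, z.2]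
  set f := F.subst γ with hf
  have hfa : f.a = F.eval q.1 q.2 := by rw [hf, BinaryCubic.subst_a_eq_eval]; rfl
  have hfb : f.b = z.1 * F.derivU q.1 q.2 + z.2 * F.derivV q.1 q.2 := by
    rw [hf, BinaryCubic.subst_b_eq_deriv]; rfl
  have heval : F.eval q'.1 q'.2 = f.a * cc ^ 3 + f.b * cc ^ 2 * (p : ℤ) ^ j +
      f.c * cc * ((p : ℤ) ^ j) ^ 2 + f.d * ((p : ℤ) ^ j) ^ 3 := by
    have := BinaryCubic.eval_subst F γ cc ((p : ℤ) ^ j)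
    rw [← hf] at this
    simp only [γ, Matrix.of_apply, Matrix.cons_val', Matrix.cons_val_zero, Matrix.cons_val_one,
      Matrix.cons_val_fin_one, Matrix.empty_val'] at this
    rw [hq'1, hq'2, ← this]; simp only [BinaryCubic.eval]
  -- divisibility by `p^(j+1)` of everything but the `b`-term
  have hpj1 : (p : ℤ) ^ (j + 1) ∣ f.b * cc ^ 2 * (p : ℤ) ^ j := by
    have e1 : (p : ℤ) ^ (j + 1) ∣ F.eval q'.1 q'.2 := (pow_dvd_pow _ (by omega)).trans hk'
    have e2 : (p : ℤ) ^ (j + 1) ∣ f.a * cc ^ 3 :=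
      ((pow_dvd_pow _ (by omega)).trans (hfa ▸ hk)).mul_right _
    have e3 : (p : ℤ) ^ (j + 1) ∣ f.c * cc * ((p : ℤ) ^ j) ^ 2 := by
      refine Dvd.dvd.mul_left ?_ _
      rw [← pow_mul]; exact pow_dvd_pow _ (by omega)
    have e4 : (p : ℤ) ^ (j + 1) ∣ f.d * ((p : ℤ) ^ j) ^ 3 := by
      refine Dvd.dvd.mul_left ?_ _
      rw [← pow_mul]; exact pow_dvd_pow _ (by omega)
    have : f.b * cc ^ 2 * (p : ℤ) ^ j =
        F.eval q'.1 q'.2 - f.a * cc ^ 3 - f.c * cc * ((p : ℤ) ^ j) ^ 2 - f.d * ((p : ℤ) ^ j) ^ 3 := by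
      rw [heval]; ring
    rw [this]; exact dvd_sub (dvd_sub (dvd_sub e1 e2) e3) e4
  have hpb : (p : ℤ) ∣ f.b := by
    rw [pow_succ'] at hpj1
    have h := (mul_dvd_mul_iff_right (pow_ne_zero j hp'.ne_zero)).mp hpj1
    rcases hp'.dvd_or_dvd h with h | h
    · exact h
    · exact absurd (hp'.dvd_of_dvd_pow h) hpcc
  -- `∇F(q) ≡ 0 (mod p)`: combine `f.b` and Euler's identity with `det(q, z) = e`
  have hpF : (p : ℤ) ∣ F.eval q.1 q.2 :=
    (dvd_pow_self (p : ℤ) (by omega : k ≠ 0)).trans hk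
  have heu : (p : ℤ) ∣ q.1 * F.derivU q.1 q.2 + q.2 * F.derivV q.1 q.2 := by
    rw [BinaryCubic.euler_identity]; exact hpF.mul_left _
  rw [hfb] at hpb
  have hU1 : (p : ℤ) ∣ F.derivU q.1 q.2 := by
    have : (p : ℤ) ∣ e * F.derivU q.1 q.2 := by
      have : e * F.derivU q.1 q.2 = z.2 * (q.1 * F.derivU q.1 q.2 + q.2 * F.derivV q.1 q.2) -
          q.2 * (z.1 * F.derivU q.1 q.2 + z.2 * F.derivV q.1 q.2) := by rw [← hdetz]; ring
      rw [this]; exact dvd_sub (heu.mul_left _) (hpb.mul_left _)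
    exact (hp'.dvd_or_dvd this).resolve_left hpe
  have hV1 : (p : ℤ) ∣ F.derivV q.1 q.2 := by
    have : (p : ℤ) ∣ e * F.derivV q.1 q.2 := by
      have : e * F.derivV q.1 q.2 = q.1 * (z.1 * F.derivU q.1 q.2 + z.2 * F.derivV q.1 q.2) -
          z.1 * (q.1 * F.derivU q.1 q.2 + q.2 * F.derivV q.1 q.2) := by rw [← hdetz]; ring
      rw [this]; exact dvd_sub (hpb.mul_left _) (heu.mul_left _)
    exact (hp'.dvd_or_dvd this).resolve_left hpe
  have hp2 : (p : ℤ) ^ 2 ∣ F.eval q.1 q.2 := (pow_dvd_pow _ (by omega)).trans hk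
  exact hU q.1 q.2 (Int.isCoprime_iff_gcd_eq_one.mpr hq) hp2 hU1 hV1

set_option maxHeartbeats 400000 in
/-- A finset in which among any four elements two coincide under `f` has at most three `f`-values. -/
theorem card_image_le_three {ι σ : Type*} [DecidableEq σ] (T : Finset ι) (f : ι → σ)
    (h : ∀ q : Fin 4 → ι, (∀ i, q i ∈ T) → ∃ i j, i ≠ j ∧ f (q i) = f (q j)) :
    (T.image f).card ≤ 3 := by
  by_contra hcon
  push Not at hcon
  obtain ⟨s, hs, hs4⟩ := Finset.exists_subset_card_eq (Nat.succ_le_of_lt hcon)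
  obtain ⟨a, t, hat, rfl, ht3⟩ := Finset.card_eq_succ.mp hs4
  obtain ⟨x, y, z, hxy, hxz, hyz, rfl⟩ := Finset.card_eq_three.mp ht3
  have hmem : ∀ w ∈ insert a ({x, y, z} : Finset σ), ∃ i ∈ T, f i = w := fun w hw =>
    Finset.mem_image.mp (hs hw)
  obtain ⟨ia, hia, hfa⟩ := hmem a (by simp)
  obtain ⟨ix, hix, hfx⟩ := hmem x (by simp)
  obtain ⟨iy, hiy, hfy⟩ := hmem y (by simp)
  obtain ⟨iz, hiz, hfz⟩ := hmem z (by simp)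
  simp only [Finset.mem_insert, Finset.mem_singleton, not_or] at hat
  obtain ⟨i, j, hij, hfij⟩ := h ![ia, ix, iy, iz] (fun i => by fin_cases i <;> assumption)
  fin_cases i <;> fin_cases j <;> simp_all

/-- **Local class bound.** For `F ∈ U_p` and `k ≥ 1`, the primitive `q` with `pᵏ ∣ F(q)` fall into
at most three classes modulo `pᵏ`. -/
theorem card_image_cls_le {F : BinaryCubic ℤ} {p : ℕ} (hp : p.Prime) (hF : F.MemU p) {k : ℕ}
    (hk : 1 ≤ k) (T : Finset (ℤ × ℤ))
    (hT : ∀ q ∈ T, Int.gcd q.1 q.2 = 1 ∧ (p : ℤ) ^ k ∣ F.eval q.1 q.2) :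
    (T.image (cls (p ^ k))).card ≤ 3 := by
  classical
  obtain ⟨hmul, hU⟩ := BinaryCubic.memU_iff_forall_coprime.mp hF
  refine card_image_le_three T _ fun q hq => ?_
  have hq1 : ∀ i, (p : ℤ) ∣ F.eval (q i).1 (q i).2 := fun i =>
    (dvd_pow_self (p : ℤ) (by omega : k ≠ 0)).trans (hT _ (hq i)).2
  obtain ⟨i, j, hij, hdvd⟩ := exists_dvd_dt_of_four hp hmul q hq1
  refine ⟨i, j, hij, cls_eq (hT _ (hq i)).1 (hT _ (hq j)).1 ?_⟩
  push_cast
  exact pow_dvd_dt hp hU (hT _ (hq i)).1 (hT _ (hq j)).1 (hT _ (hq i)).2 (hT _ (hq j)).2 hdvd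

/-- `M ∣ z` from `p^{v_p(M)} ∣ z` for every prime factor `p` of `M`. -/
theorem natCast_dvd_of_primeFactors {M : ℕ} (hM : M ≠ 0) {z : ℤ}
    (h : ∀ p ∈ M.primeFactors, ((p ^ M.factorization p : ℕ) : ℤ) ∣ z) : (M : ℤ) ∣ z := by
  rw [Int.natCast_dvd]
  by_cases hz : z.natAbs = 0
  · rw [hz]; exact dvd_zero _
  rw [← Nat.factorization_le_iff_dvd hM hz]
  intro p
  by_cases hp : p ∈ M.primeFactors
  · have h' : p ^ M.factorization p ∣ z.natAbs := by
      have := h p hp; rwa [Int.natCast_dvd] at this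
    exact (Nat.Prime.pow_dvd_iff_le_factorization (Nat.prime_of_mem_primeFactors hp) hz).mp h'
  · rw [Finsupp.notMem_support_iff.mp (by rwa [Nat.support_factorization])]; exact Nat.zero_le _

/-- **Classes modulo `M` (CRT).** If `F ∈ U_p` for all `p ∣ M`, a finite set `T` of primitive `q`
with `M ∣ F(q)` in which every class `{q : M ∣ det(q₀, q)}` has at most `b` elements has at most
`3^{ω(M)} · b` elements. -/
theorem card_le_of_classes {F : BinaryCubic ℤ} {M : ℕ} (hM : 0 < M)
    (hU : ∀ p ∈ M.primeFactors, F.MemU p) (T : Finset (ℤ × ℤ))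
    (hT : ∀ q ∈ T, Int.gcd q.1 q.2 = 1 ∧ (M : ℤ) ∣ F.eval q.1 q.2) (b : ℕ)
    (hb : ∀ q₀ ∈ T, (T.filter (fun q => (M : ℤ) ∣ dt q₀ q)).card ≤ b) :
    T.card ≤ 3 ^ M.primeFactors.card * b := by
  classical
  let key : (ℤ × ℤ) → (M.primeFactors → Set (ℤ × ℤ)) :=
    fun q pf => cls (pf.1 ^ M.factorization pf.1) q
  have h1 : T.card ≤ b * (T.image key).card := by
    refine Finset.card_le_mul_card_image T b fun τ hτ => ?_
    obtain ⟨q₀, hq₀, rfl⟩ := Finset.mem_image.mp hτ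
    refine le_trans (Finset.card_le_card fun q hq => ?_) (hb q₀ hq₀)
    simp only [Finset.mem_filter] at hq ⊢
    refine ⟨hq.1, natCast_dvd_of_primeFactors hM.ne' fun p hp => ?_⟩
    have := congr_fun hq.2 ⟨p, hp⟩
    simp only [key] at this
    have hmem := mem_cls_self (p ^ M.factorization p) q
    rw [this] at hmem
    exact hmem
  have h2 : (T.image key).card ≤ ∏ pf : M.primeFactors,
      (T.image (fun q => cls (pf.1 ^ M.factorization pf.1) q)).card := by
    rw [← Fintype.card_piFinset]
    refine Finset.card_le_card fun τ hτ => ?_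
    obtain ⟨q₀, hq₀, rfl⟩ := Finset.mem_image.mp hτ
    exact Fintype.mem_piFinset.mpr fun pf => Finset.mem_image_of_mem _ hq₀
  have h3 : ∀ pf : M.primeFactors,
      (T.image (fun q => cls (pf.1 ^ M.factorization pf.1) q)).card ≤ 3 := by
    intro ⟨p, hp⟩
    have hpp := Nat.prime_of_mem_primeFactors hp
    refine card_image_cls_le hpp (hU p hp) (hpp.factorization_pos_of_dvd hM.ne'
      (Nat.dvd_of_mem_primeFactors hp)) T fun q hq => ⟨(hT q hq).1, ?_⟩
    have : ((p ^ M.factorization p : ℕ) : ℤ) ∣ (M : ℤ) := by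
      exact_mod_cast Nat.ordProj_dvd M p
    push_cast at this
    exact this.trans (hT q hq).2
  calc T.card ≤ b * (T.image key).card := h1
    _ ≤ b * 3 ^ M.primeFactors.card := by
        gcongr
        refine h2.trans ?_
        calc _ ≤ 3 ^ (Finset.univ : Finset M.primeFactors).card :=
              Finset.prod_le_pow_card _ _ _ fun pf _ => h3 pf
          _ = 3 ^ M.primeFactors.card := by rw [Finset.card_univ, Fintype.card_coe]
    _ = 3 ^ M.primeFactors.card * b := by ring

/-- `c^{ω(n)} ≤ K n^δ` (a prime `p ≥ c^{1/δ}` contributes `c ≤ p^δ`, the smaller ones `≤ c` each). -/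
theorem pow_card_primeFactors_le {c δ : ℝ} (hc : 1 ≤ c) (hδ : 0 < δ) :
    ∃ K : ℝ, 0 < K ∧ ∀ n : ℕ, n ≠ 0 → c ^ n.primeFactors.card ≤ K * (n : ℝ) ^ δ := by
  set T : ℝ := c ^ (1 / δ) with hT
  refine ⟨c ^ ⌈T⌉₊, by positivity, fun n hn => ?_⟩
  classical
  have hsplit := Finset.card_filter_add_card_filter_not (s := n.primeFactors)
    (fun p : ℕ => (p : ℝ) < T)
  rw [← hsplit, pow_add]
  refine mul_le_mul ?_ ?_ (by positivity) (by positivity)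
  · refine pow_le_pow_right₀ hc ?_
    calc (n.primeFactors.filter (fun p : ℕ => (p : ℝ) < T)).card ≤ (Finset.range ⌈T⌉₊).card := by
          refine Finset.card_le_card fun p hp => ?_
          simp only [Finset.mem_filter] at hp
          exact Finset.mem_range.mpr (Nat.lt_ceil.mpr hp.2)
      _ = ⌈T⌉₊ := Finset.card_range _
  · calc c ^ (n.primeFactors.filter (fun p : ℕ => ¬ (p : ℝ) < T)).card
        = ∏ p ∈ n.primeFactors.filter (fun p : ℕ => ¬ (p : ℝ) < T), c := by
          rw [Finset.prod_const]
      _ ≤ ∏ p ∈ n.primeFactors.filter (fun p : ℕ => ¬ (p : ℝ) < T), (p : ℝ) ^ δ := by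
          refine Finset.prod_le_prod (fun _ _ => by positivity) fun p hp => ?_
          simp only [Finset.mem_filter, not_lt] at hp
          calc c = T ^ δ := by
                rw [hT, ← Real.rpow_mul (by positivity), one_div_mul_cancel hδ.ne',
                  Real.rpow_one]
            _ ≤ (p : ℝ) ^ δ := Real.rpow_le_rpow (by positivity) hp.2 hδ.le
      _ ≤ ∏ p ∈ n.primeFactors, (p : ℝ) ^ δ := by
          refine Finset.prod_le_prod_of_subset_of_one_le (Finset.filter_subset _ _)
            (fun _ _ => by positivity) fun p hp _ => Real.one_le_rpow ?_ hδ.le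
          exact_mod_cast (Nat.prime_of_mem_primeFactors hp).one_le
      _ = ((∏ p ∈ n.primeFactors, p : ℕ) : ℝ) ^ δ := by
          rw [Nat.cast_prod, Real.finsetProd_rpow _ _ (fun i _ => by positivity)]
      _ ≤ (n : ℝ) ^ δ := by
          refine Real.rpow_le_rpow (by positivity) ?_ hδ.le
          exact_mod_cast Nat.le_of_dvd (Nat.pos_of_ne_zero hn) (Nat.prod_primeFactors_dvd n)

/-- **Registered export** (support file 3/4 of `stub_latticeHalf`): if `F ∈ U_p` for all `p ∣ M`, a
finite set of primitive `q` with `M ∣ F(q)` in which every class modulo `M` has at most `b` elements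
has at most `3^{ω(M)} · b` elements. -/
theorem latticeArith_main : ∀ (F : BinaryCubic ℤ) (M : ℕ), 0 < M → (∀ p ∈ M.primeFactors, F.MemU p) → ∀ (T : Finset (ℤ × ℤ)), (∀ q ∈ T, Int.gcd q.1 q.2 = 1 ∧ (M : ℤ) ∣ F.eval q.1 q.2) → ∀ (b : ℕ), (∀ q₀ ∈ T, (T.filter (fun q => (M : ℤ) ∣ dt q₀ q)).card ≤ b) → T.card ≤ 3 ^ M.primeFactors.card * b :=
  fun _ _ hM hU T hT b hb => card_le_of_classes hM hU T hT b hb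

end Summit.ABC.ABC.Theorems.SharpModerateLaw

end
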